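import Literature.Geometry.Kaehler.ComplexTorusAbelianSurfaceQuaternionMultiplicationHodgeEqLefschetz
import Literature.Geometry.Kaehler.ComplexTorusAbelianSurfaceShimura
import Literature.Geometry.Kaehler.ComplexTorusAlbertClassificationLowDimension
import Literature.Geometry.Kaehler.ComplexTorusAlbertTypeILefschetzGroupConnected
import HarnessLib

/-!
# Moonen–Zarhin 1999, «condition (D) for `dim X ≤ 3`» (§3) for SIMPLE abelian SURFACES whose Rosati involution is of the FIRST
# KIND (Albert types I(1), I(2), II(1) — all simple surfaces that are not of CM type IV(2,1)): `Hg(X) = Lf(X) = S(X)` and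
# `ℬ•(Xⁿ) = 𝒟•(Xⁿ)` for every `n`;
# the Type I front-ends in the tree's Albert currency, and «stably nondegenerate ⟺ `Hg = Lf`» for EVERY simple surface

Layer `Literature/Geometry/Kaehler`, namespace `Literature.Geometry.Kaehler.ComplexTorus`; lane `lit-hodgefound`
(Track 2 foundations library), Layer A4, prover seat p17 (generation 48), self-proposed row g48-#2 — the ASSEMBLY of the
lane's three non-CM entries of Moonen–Zarhin's list (2.2) for `g = 2` at torus level: Type I(1) (g47-#1
`ComplexTorusAbelianSurfaceHodgeGeneral`: `End⁰(X) = ℚ ⟹ Hg(X) = Sp(V, E)`), Type I(2) (g47-#10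
`ComplexTorusAbelianSurfaceRealMultiplicationHodgeEqLefschetz`: real quadratic `End⁰(X) = f(K)`), Type II(1) (g48-#1
`ComplexTorusAbelianSurfaceQuaternionMultiplicationHodgeEqLefschetz`), through the tree's Albert sorting of a simple polarised
torus (`IsSimple.isAlbertType_of_finrank_le_seven`: type I ∨ II ∨ III ∨ IV over the centre `K = centerField Ψ hX` with the
Rosati involution `rosatiEnd`) and Shimura's exclusion of type III at `g = 2` (`IsSimple.not_isAlbertTypeIII_of_finrank_eq_two`,
`ComplexTorusAbelianSurfaceShimura`).  THEOREMS ONLY (no definition, no instance, no notation, no named fact; D-0026, net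
debt 0); everything is consumed BY NAME.

## Sources, VERBATIM

* B. J. J. Moonen, Yu. G. Zarhin, *Hodge classes on abelian varieties of low dimension*, Math. Ann. **315** (1999)
  711–733, held `paper:arxiv-math_9901113`: §2 (p0005 L20–L22) «For `g := dim(X) ≤ 3` and `g = 5` we always find that
  `Hg(X) = Sp_D(V,φ)`. Since type III does not occur for `g ≤ 3` and `g = 5` (`X` simple!), it follows that
  `ℬ•(Xⁿ) = 𝒟•(Xⁿ)` for all `n`»; (2.2) `g = 2` (p0005 L53–L78) «There are four cases. Type I(1): `X` is an abelian surface
  with `End⁰(X) = ℚ`. Then `Hg(X) = Sp(V,φ) ≅ Sp_{4,ℚ}`. Type I(2): `End⁰(X) = F` is a real quadratic field. […]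
  `Hg(X) = Res_{F/ℚ} Sp_F(V,ψ)`. Type II(1): `D = End⁰(X)` is a quaternion algebra over `ℚ`, split at `∞`. […] Then `Hg(X)`
  is the algebraic group `U_{D^opp}` […]. Type IV(2,1): `End⁰(X) = F` is a quartic CM-field not containing an imaginary
  quadratic subfield. We have `Hg(X) = U_F`»; §3 (p0008 L107–L111) «Combining this with Corollary (…), we have proven (…) in
  case `dim(X) ≤ 3`. In particular, for every complex abelian variety `X` of dimension `≤ 3` we have `Hg(X) = Sp_D(V,φ)` and
  condition (D) in (…) is satisfied» (condition (D), §1 p0004 L61–L66: «`ℬ•(Xⁿ) = 𝒟•(Xⁿ)` for all `n`»); Introduction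
  (p0001 L62–L64) «If `dim(X) ≤ 3` then every Hodge class on `X` is a linear combination of products of divisor classes».
  LOCATOR NOTE: the held TeX carries no statement numbers; «(2.2)» is the `g = 2` list of §2 (p0005 L53 ff.), and the
  lane's earlier locator «(2.4) Theorem (p0005 L88–L90)» for the `dim ≤ 3` sentence (g47-#10, and this file as first
  filed) is corrected here — p0005 L88–L90 is the Type I(3) entry of the `g = 3` list; the printed (2.4) is the
  Proposition on simple `X` with `g ≤ 3` (p0005 L110 ff.).
* H. Lange, *Abelian Varieties over the Complex Numbers* (2023), §2.6.2 (p. 141: «of the first kind if the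
  anti-involution is trivial on the centre `K` of `F`»), Thm. 2.6.5 (types I–III = first kind), §5.1.5 Exercise (2)(b),
  §2.6.1 Proposition (`e ∣ g` for type I).
* K. Hulek, R. Laface, *On the Picard numbers of abelian varieties*, Ann. Sc. Norm. Super. Pisa (2019), §5.1 Prop. 5.1
  (Shimura's exceptional cases: no type III, no imaginary quadratic `End⁰` for a simple surface).
* B. B. Gordon, *A survey of the Hodge conjecture for abelian varieties* (1999), Thm. 7.5 ((1) ⟺ (2)); J. S. Milne,
  *Lefschetz classes on abelian varieties* (1999), §2 Summary table and §4 Prop. 4.8.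

## Contents

* §1 `F = K` for type I: `IsSimple.range_valAlgHom_eq_endAlgRat_of_finrank_eq_one` (`End⁰(X) = val(K)`),
  `IsSimple.endAlgRat_eq_bot_of_finrank_eq_one_of_finrank_centerField_eq_one` (`e = 1 ⟹ End⁰(X) = ℚ`).
* §2 TYPE I FRONT-ENDS (`g = 2`): **`IsSimple.hodgeGroup_eq_lefschetzIdentity_of_isAlbertTypeI_of_finrank_eq_two`**
  (`Hg(X)(ℝ) = Lf(X)(ℝ)`: `e = [K:ℚ] ∣ g = 2`; `e = 1` ⟹ `End⁰(X) = ℚ`, `Hg = Sp = Lf` by g47-#1; `e = 2` ⟹ g47-#10 with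
  `f = centerField.valAlgHom`), `…_eq_lefschetzGroup_…` (`= S(X)(ℝ)`),
  **`IsSimple.forall_divisorClasses_powPeriod_eq_hodgeClasses_of_isAlbertTypeI_of_finrank_eq_two`** (`ℬ•(Xⁿ) = 𝒟•(Xⁿ)`).
* §3 NOT OF TYPE IV ∕ FIRST KIND (`g = 2`): **`IsSimple.hodgeGroup_eq_lefschetzIdentity_of_not_isAlbertTypeIV_of_finrank_eq_two`**,
  **`IsSimple.forall_divisorClasses_powPeriod_eq_hodgeClasses_of_not_isAlbertTypeIV_of_finrank_eq_two`**, and the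
  `IsOfFirstKind` ∕ `IsTotallyReal (centerField Ψ hX)` forms — MZ's condition (D) for every simple surface with `End⁰(X)`
  of type I(1), I(2) or II(1).
* §4 EVERY SIMPLE SURFACE: `IsSimple.forall_divisorClasses_powPeriod_eq_hodgeClasses_iff_hodgeGroup_eq_lefschetzIdentity_of_finrank_eq_two`
  (stably nondegenerate ⟺ `Hg(X)(ℝ) = Lf(X)(ℝ)`, no type hypothesis: type III does not occur) and `…_lefschetzGroup_…`.

NOT here (recorded as the remaining case of condition (D) for simple surfaces at torus level): Type IV(2,1), `End⁰(X) = F` a quartic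
CM field, «`Hg(X) = U_F`» — it needs `dim Hg(X) = 2` for an ARBITRARY simple torus with such an `F` (the tree has it for the
CM-type models `periodIso Φ I`, `ComplexTorusCMTypeModelsHodgeClassesDegreeLeSix`).
-/

noncomputable section

open Module Matrix NumberField
open Literature.RingTheory.CentralSimple (IsAlbertTypeI IsAlbertTypeII IsAlbertTypeIII IsAlbertTypeIV IsOfFirstKind)

namespace Literature.Geometry.Kaehler

namespace ComplexTorus

variable {κ : Type} [Fintype κ] [DecidableEq κ] [Nonempty κ] {E : Type} [NormedAddCommGroup E] [NormedSpace ℂ E]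
  [FiniteDimensional ℂ E] {Ψ : (κ → ℝ) ≃L[ℝ] E} {η : E [⋀^Fin 2]→L[ℝ] ℝ} {G : Matrix κ κ ℚ}

/-! ## §1 `F = K` for pairs of type I: `End⁰(X)` is the image of its centre -/

omit [FiniteDimensional ℂ E] in
/-- `End_ℚ(X)` is a non-trivial ring. [folklore] -/
private theorem nontrivial_endAlgRat₄₈ (Ψ : (κ → ℝ) ≃L[ℝ] E) : Nontrivial (endAlgRat Ψ) :=
  ⟨⟨0, 1, fun h ↦ zero_ne_one (congrArg Subtype.val h)⟩⟩

omit [FiniteDimensional ℂ E] in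
/-- **`[F : K] = 1 ⟹ End⁰(X) = K`**: when the endomorphism algebra of a simple torus has degree `1` over its centre, every
endomorphism is (the rational representation of) a central one — `End_ℚ(X) = val(K)` («`F = K`», Lange's table, line
«totally real number field», `d = 1`). [cite: Lange2023AbelianVarietiesComplex, §2.6.1 Proposition, table (`d = 1`: `F = K`) and Thm. 2.6.5 (a)] -/
theorem IsSimple.range_valAlgHom_eq_endAlgRat_of_finrank_eq_one (hX : IsSimple Ψ)
    (h1 : finrank (centerField Ψ hX) (endAlgRat Ψ) = 1) :
    (centerField.valAlgHom Ψ hX).range = endAlgRat Ψ := by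
  haveI := nontrivial_endAlgRat₄₈ Ψ
  have hbij := (Algebra.finrank_eq_one_iff_bijective_algebraMap (F := centerField Ψ hX)
    (E := endAlgRat Ψ)).1 h1
  refine le_antisymm (fun A hA ↦ ?_) fun A hA ↦ ?_
  · obtain ⟨z, rfl⟩ := (AlgHom.mem_range _).1 hA
    rw [centerField.valAlgHom_apply]
    exact centerField.val_mem Ψ hX z
  · obtain ⟨z, hz⟩ := hbij.2 ⟨A, hA⟩
    refine (AlgHom.mem_range _).2 ⟨z, ?_⟩
    rw [centerField.valAlgHom_apply, ← centerField.coe_algebraMap, hz]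

omit [FiniteDimensional ℂ E] in
/-- **`[F : K] = 1` and `[K : ℚ] = 1 ⟹ End⁰(X) = ℚ`** (Type I(1): «`X` is an abelian surface with `End⁰(X) = ℚ`»).
[cite: MoonenZarhin1999LowDim, §2 (2.2) `g = 2` («Type I(1)»)] [cite: Lange2023AbelianVarietiesComplex, §2.6.1 Proposition, table (`d = 1`, `e = 1`)] -/
theorem IsSimple.endAlgRat_eq_bot_of_finrank_eq_one_of_finrank_centerField_eq_one (hX : IsSimple Ψ)
    (h1 : finrank (centerField Ψ hX) (endAlgRat Ψ) = 1) (he : finrank ℚ (centerField Ψ hX) = 1) :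
    endAlgRat Ψ = ⊥ := by
  rw [← hX.range_valAlgHom_eq_endAlgRat_of_finrank_eq_one h1]
  refine eq_bot_iff.2 fun A hA ↦ ?_
  obtain ⟨z, rfl⟩ := (AlgHom.mem_range _).1 hA
  obtain ⟨q, hq⟩ := (finrank_eq_one_iff_of_nonzero' (1 : centerField Ψ hX) one_ne_zero).1 he z
  rw [← hq, map_smul, map_one]
  exact Subalgebra.smul_mem _ (Subalgebra.one_mem _) q

/-! ## §2 Type I simple surfaces: `Hg(X) = Lf(X) = S(X)` and `ℬ•(Xⁿ) = 𝒟•(Xⁿ)` -/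

/-- **MOONEN–ZARHIN (2.2) ∕ §3, TYPE I, `g = 2`: `Hg(X)(ℝ) = Lf(X)(ℝ)`** for a simple polarised complex abelian surface whose
pair `(End⁰(X), ′)` is of Albert type I over the centre `K` (`F = K` totally real): `e = [K : ℚ] ∣ g = 2`; for `e = 1`,
`End⁰(X) = ℚ` and `Hg(X) = Sp(V, E) = Lf(X)` («Type I(1)», g47-#1 `IsRiemannForm.hodgeGroup_eq_spGroup_of_finrank_eq_two_of_endAlgRat_eq_bot`);
for `e = 2`, `End⁰(X) = val(K)` is a real quadratic field and `Hg(X) = Res_{F/ℚ} SL_{2,F} = Lf(X)` («Type I(2)», g47-#10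
`IsRiemannForm.hodgeGroup_eq_lefschetzIdentity_of_finrank_eq_two` with `f = centerField.valAlgHom`).
[cite: MoonenZarhin1999LowDim, §2 (2.2) `g = 2` («Type I(1)», «Type I(2)») and §3 (p0008 L107–L111: «for every complex abelian variety `X` of dimension `≤ 3` we have `Hg(X) = Sp_D(V,φ)` and condition (D) … is satisfied»)]
[cite: Lange2023AbelianVarietiesComplex, §2.6.1 Proposition (table: type I, `e ∣ g`) and §5.1.5 Exercise (2)(b)] -/
theorem IsSimple.hodgeGroup_eq_lefschetzIdentity_of_isAlbertTypeI_of_finrank_eq_two (hX : IsSimple Ψ)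
    (hη : IsRiemannForm Ψ η) (hG : G.map (Rat.cast : ℚ → ℝ) = latticeGram Ψ η)
    (h : IsAlbertTypeI (centerField Ψ hX) (endAlgRat Ψ) (rosatiEnd Ψ hη.1 hη.2.2 hG)) (h2 : finrank ℂ E = 2) :
    hodgeGroup Ψ = lefschetzIdentity Ψ G := by
  haveI : IsTotallyReal (centerField Ψ hX) := h.isTotallyReal
  have hF := hX.range_valAlgHom_eq_endAlgRat_of_finrank_eq_one h.finrank_eq_one
  have hdvd : finrank ℚ (centerField Ψ hX) ∣ finrank ℂ E := hX.finrank_centerField_dvd_of_isTotallyReal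
  rw [h2] at hdvd
  have hpos : 0 < finrank ℚ (centerField Ψ hX) := finrank_pos
  have hle : finrank ℚ (centerField Ψ hX) ≤ 2 := Nat.le_of_dvd two_pos hdvd
  rcases (show finrank ℚ (centerField Ψ hX) = 1 ∨ finrank ℚ (centerField Ψ hX) = 2 by omega) with he | he
  · -- Type I(1): `End⁰(X) = ℚ`, `Hg = Sp = Lf`
    have hbot := hX.endAlgRat_eq_bot_of_finrank_eq_one_of_finrank_centerField_eq_one h.finrank_eq_one he
    rw [hη.hodgeGroup_eq_spGroup_of_finrank_eq_two_of_endAlgRat_eq_bot h2 hbot,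
      hη.lefschetzIdentity_eq_spGroup_of_endAlgRat_eq_bot hG hbot]
  · -- Type I(2): real multiplication by the quadratic field `K`
    exact hη.hodgeGroup_eq_lefschetzIdentity_of_finrank_eq_two h2 he (centerField.valAlgHom Ψ hX) hF hG

/-- **Type I, `g = 2`: `Hg(X)(ℝ) = S(X)(ℝ)`** (Milne's centraliser; «I ∣ Sp ∣ Connected: Yes»).
[cite: MoonenZarhin1999LowDim, §2 («`Hg(X) = Sp_D(V,φ)`») and (2.2) `g = 2`] [cite: Milne1999LefschetzClasses, §2 Summary table (type I)] -/
theorem IsSimple.hodgeGroup_eq_lefschetzGroup_of_isAlbertTypeI_of_finrank_eq_two (hX : IsSimple Ψ)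
    (hη : IsRiemannForm Ψ η) (hG : G.map (Rat.cast : ℚ → ℝ) = latticeGram Ψ η)
    (h : IsAlbertTypeI (centerField Ψ hX) (endAlgRat Ψ) (rosatiEnd Ψ hη.1 hη.2.2 hG)) (h2 : finrank ℂ E = 2) :
    hodgeGroup Ψ = lefschetzGroup Ψ η := by
  rw [hX.hodgeGroup_eq_lefschetzIdentity_of_isAlbertTypeI_of_finrank_eq_two hη hG h h2,
    hX.lefschetzIdentity_eq_lefschetzGroup_of_isAlbertTypeI hη hG h]

/-- **MOONEN–ZARHIN, CONDITION (D), TYPE I, `g = 2`: `ℬ•(Xⁿ) = 𝒟•(Xⁿ)` for every `n`** — a simple polarised abelian surface of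
Albert type I (`End⁰(X) = ℚ` or a real quadratic field) is stably nondegenerate. [cite: MoonenZarhin1999LowDim, §3 (p0008 L107–L111: «for every complex abelian variety `X` of dimension `≤ 3` we have `Hg(X) = Sp_D(V,φ)` and condition (D) … is satisfied»), §1 (D) (p0004 L61–L66) and §2 (p0005 L20–L22)]
[cite: Gordon1999HodgeAVSurvey, Thm. 7.5 (1) ⟺ (2) and Thm. 6.2] -/
theorem IsSimple.forall_divisorClasses_powPeriod_eq_hodgeClasses_of_isAlbertTypeI_of_finrank_eq_two (hX : IsSimple Ψ)
    (hη : IsRiemannForm Ψ η) (hG : G.map (Rat.cast : ℚ → ℝ) = latticeGram Ψ η)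
    (h : IsAlbertTypeI (centerField Ψ hX) (endAlgRat Ψ) (rosatiEnd Ψ hη.1 hη.2.2 hG)) (h2 : finrank ℂ E = 2) :
    ∀ k p : ℕ, divisorClasses (powPeriod Ψ k) p = hodgeClasses (powPeriod Ψ k) p :=
  (hX.forall_divisorClasses_powPeriod_eq_hodgeClasses_iff_hodgeGroup_eq_lefschetzIdentity_of_isAlbertTypeI hη hG h).2
    (hX.hodgeGroup_eq_lefschetzIdentity_of_isAlbertTypeI_of_finrank_eq_two hη hG h h2)

/-! ## §3 Simple surfaces not of type IV (Rosati involution of the first kind): Types I(1), I(2), II(1) together -/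

/-- **`Hg(X)(ℝ) = Lf(X)(ℝ)` FOR EVERY SIMPLE POLARISED ABELIAN SURFACE NOT OF ALBERT TYPE IV** — the pair `(End⁰(X), ′)` is
of type I, II, III or IV (Albert, `IsSimple.isAlbertType_of_finrank_le_seven`), type III does not occur for a simple surface
(Shimura; `IsSimple.not_isAlbertTypeII_of_finrank_eq_two`'s sibling `…not_isAlbertTypeIII…`), type I is §2 and type II is
g48-#1.  («Type I(1) … Type I(2) … Type II(1)»: the three non-CM cases of (2.2), `g = 2`.)
[cite: MoonenZarhin1999LowDim, §2 (2.2) `g = 2` and §3 (p0008 L107–L111: «for every complex abelian variety `X` of dimension `≤ 3` we have `Hg(X) = Sp_D(V,φ)` and condition (D) … is satisfied»)]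
[cite: HulekLaface2019PicardNumbersAV, §5.1 Prop. 5.1 (no type III for a simple surface)] [cite: Lange2023AbelianVarietiesComplex, Thm. 2.6.5 and §5.1.5 Exercise (2)(b)] -/
theorem IsSimple.hodgeGroup_eq_lefschetzIdentity_of_not_isAlbertTypeIV_of_finrank_eq_two (hX : IsSimple Ψ)
    (hη : IsRiemannForm Ψ η) (hG : G.map (Rat.cast : ℚ → ℝ) = latticeGram Ψ η)
    (hIV : ¬ IsAlbertTypeIV (centerField Ψ hX) (endAlgRat Ψ) (rosatiEnd Ψ hη.1 hη.2.2 hG)) (h2 : finrank ℂ E = 2) :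
    hodgeGroup Ψ = lefschetzIdentity Ψ G := by
  rcases hX.isAlbertType_of_finrank_le_seven hη hG (by omega) with hI | hII | hIII | hIV'
  · exact hX.hodgeGroup_eq_lefschetzIdentity_of_isAlbertTypeI_of_finrank_eq_two hη hG hI h2
  · exact hX.hodgeGroup_eq_lefschetzIdentity_of_isAlbertTypeII_of_finrank_eq_two hη hG hII h2
  · exact absurd hIII (hX.not_isAlbertTypeIII_of_finrank_eq_two hη hG h2)
  · exact absurd hIV' hIV

/-- **MOONEN–ZARHIN, CONDITION (D) FOR EVERY SIMPLE ABELIAN SURFACE NOT OF TYPE IV: `ℬ•(Xⁿ) = 𝒟•(Xⁿ)` for every `n`** (stably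
nondegenerate; Types I(1), I(2), II(1)). [cite: MoonenZarhin1999LowDim, §3 (p0008 L107–L111: «for every complex abelian variety `X` of dimension `≤ 3` we have `Hg(X) = Sp_D(V,φ)` and condition (D) … is satisfied»), §1 (D) (p0004 L61–L66) and §2 (p0005 L20–L22: «Since type III does not occur for `g ≤ 3` … it follows that `ℬ•(Xⁿ) = 𝒟•(Xⁿ)` for all `n`»)]
[cite: Gordon1999HodgeAVSurvey, Thm. 7.5 (1) ⟺ (2)] [cite: HulekLaface2019PicardNumbersAV, §5.1 Prop. 5.1] -/
theorem IsSimple.forall_divisorClasses_powPeriod_eq_hodgeClasses_of_not_isAlbertTypeIV_of_finrank_eq_two (hX : IsSimple Ψ)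
    (hη : IsRiemannForm Ψ η) (hG : G.map (Rat.cast : ℚ → ℝ) = latticeGram Ψ η)
    (hIV : ¬ IsAlbertTypeIV (centerField Ψ hX) (endAlgRat Ψ) (rosatiEnd Ψ hη.1 hη.2.2 hG)) (h2 : finrank ℂ E = 2) :
    ∀ k p : ℕ, divisorClasses (powPeriod Ψ k) p = hodgeClasses (powPeriod Ψ k) p :=
  (hX.forall_divisorClasses_powPeriod_eq_hodgeClasses_iff_hodgeGroup_eq_lefschetzIdentity_of_not_isAlbertTypeIII hη hG
    (by omega) (hX.not_isAlbertTypeIII_of_finrank_eq_two hη hG h2)).2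
    (hX.hodgeGroup_eq_lefschetzIdentity_of_not_isAlbertTypeIV_of_finrank_eq_two hη hG hIV h2)

/-- **FIRST KIND, `g = 2`: `Hg(X)(ℝ) = Lf(X)(ℝ)`** — if the Rosati involution of a simple polarised abelian surface is trivial on the
centre of `End⁰(X)` (of the first kind: types I, II, III of Albert; type IV is of the second kind), then `Hg(X) = Lf(X)`.
[cite: Lange2023AbelianVarietiesComplex, §2.6.2 (p. 141: first ∕ second kind) and Thm. 2.6.5] [cite: MoonenZarhin1999LowDim, §2 (2.2) `g = 2` and §3 (p0008 L107–L111)] -/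
theorem IsSimple.hodgeGroup_eq_lefschetzIdentity_of_isOfFirstKind_of_finrank_eq_two (hX : IsSimple Ψ)
    (hη : IsRiemannForm Ψ η) (hG : G.map (Rat.cast : ℚ → ℝ) = latticeGram Ψ η)
    (h : IsOfFirstKind (centerField Ψ hX) (endAlgRat Ψ) (rosatiEnd Ψ hη.1 hη.2.2 hG)) (h2 : finrank ℂ E = 2) :
    hodgeGroup Ψ = lefschetzIdentity Ψ G :=
  haveI := nontrivial_endAlgRat₄₈ Ψ
  hX.hodgeGroup_eq_lefschetzIdentity_of_not_isAlbertTypeIV_of_finrank_eq_two hη hG (fun hIV ↦ hIV.not_isOfFirstKind h) h2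

/-- **FIRST KIND, `g = 2`: `ℬ•(Xⁿ) = 𝒟•(Xⁿ)` for every `n`.** [cite: MoonenZarhin1999LowDim, §3 (p0008 L107–L111) and §1 (D) (p0004 L61–L66)]
[cite: Lange2023AbelianVarietiesComplex, §2.6.2 (first kind) and Thm. 2.6.5] [cite: Gordon1999HodgeAVSurvey, Thm. 7.5 (1) ⟺ (2)] -/
theorem IsSimple.forall_divisorClasses_powPeriod_eq_hodgeClasses_of_isOfFirstKind_of_finrank_eq_two (hX : IsSimple Ψ)
    (hη : IsRiemannForm Ψ η) (hG : G.map (Rat.cast : ℚ → ℝ) = latticeGram Ψ η)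
    (h : IsOfFirstKind (centerField Ψ hX) (endAlgRat Ψ) (rosatiEnd Ψ hη.1 hη.2.2 hG)) (h2 : finrank ℂ E = 2) :
    ∀ k p : ℕ, divisorClasses (powPeriod Ψ k) p = hodgeClasses (powPeriod Ψ k) p :=
  haveI := nontrivial_endAlgRat₄₈ Ψ
  hX.forall_divisorClasses_powPeriod_eq_hodgeClasses_of_not_isAlbertTypeIV_of_finrank_eq_two hη hG
    (fun hIV ↦ hIV.not_isOfFirstKind h) h2

/-- **TOTALLY REAL CENTRE, `g = 2`: `Hg(X)(ℝ) = Lf(X)(ℝ)`** — a simple polarised abelian surface whose endomorphism algebra has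
totally real centre (so `End⁰(X)` is `ℚ`, a real quadratic field or an indefinite quaternion algebra over `ℚ`; the centre of
a type IV pair is a CM field). [cite: MoonenZarhin1999LowDim, §2 (2.2) `g = 2` and §3 (p0008 L107–L111)] [cite: Lange2023AbelianVarietiesComplex, Lemma 2.6.4 ∕ Lemma 2.6.6 (centre totally real for the first kind, CM for the second)] -/
theorem IsSimple.hodgeGroup_eq_lefschetzIdentity_of_isTotallyReal_of_finrank_eq_two (hX : IsSimple Ψ)
    (hη : IsRiemannForm Ψ η) (hG : G.map (Rat.cast : ℚ → ℝ) = latticeGram Ψ η) [IsTotallyReal (centerField Ψ hX)]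
    (h2 : finrank ℂ E = 2) : hodgeGroup Ψ = lefschetzIdentity Ψ G := by
  refine hX.hodgeGroup_eq_lefschetzIdentity_of_not_isAlbertTypeIV_of_finrank_eq_two hη hG (fun hIV ↦ ?_) h2
  haveI := hIV.isCMField
  obtain ⟨w⟩ := (inferInstance : Nonempty (InfinitePlace (centerField Ψ hX)))
  exact (InfinitePlace.not_isReal_iff_isComplex.2 (IsTotallyComplex.isComplex w)) (IsTotallyReal.isReal w)

/-- **TOTALLY REAL CENTRE, `g = 2`: `ℬ•(Xⁿ) = 𝒟•(Xⁿ)` for every `n`.** [cite: MoonenZarhin1999LowDim, §3 (p0008 L107–L111) and §1 (D) (p0004 L61–L66)]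
[cite: Gordon1999HodgeAVSurvey, Thm. 7.5 (1) ⟺ (2)] -/
theorem IsSimple.forall_divisorClasses_powPeriod_eq_hodgeClasses_of_isTotallyReal_of_finrank_eq_two (hX : IsSimple Ψ)
    (hη : IsRiemannForm Ψ η) (hG : G.map (Rat.cast : ℚ → ℝ) = latticeGram Ψ η) [IsTotallyReal (centerField Ψ hX)]
    (h2 : finrank ℂ E = 2) : ∀ k p : ℕ, divisorClasses (powPeriod Ψ k) p = hodgeClasses (powPeriod Ψ k) p :=
  (hX.forall_divisorClasses_powPeriod_eq_hodgeClasses_iff_hodgeGroup_eq_lefschetzIdentity_of_not_isAlbertTypeIII hη hG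
    (by omega) (hX.not_isAlbertTypeIII_of_finrank_eq_two hη hG h2)).2
    (hX.hodgeGroup_eq_lefschetzIdentity_of_isTotallyReal_of_finrank_eq_two hη hG h2)

/-! ## §4 Every simple surface: stably nondegenerate ⟺ `Hg = Lf` (type III never occurs) -/

/-- **GORDON'S THM. 7.5 FOR EVERY SIMPLE ABELIAN SURFACE, WITHOUT TYPE HYPOTHESIS: stably nondegenerate ⟺ `Hg(X)(ℝ) = Lf(X)(ℝ)`**
— the clause «no factor of type (III)» is automatic for a simple surface (Shimura). [cite: Gordon1999HodgeAVSurvey, Thm. 7.5 (1) ⟺ (2)]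
[cite: HulekLaface2019PicardNumbersAV, §5.1 Prop. 5.1 (no type III for a simple surface)] [cite: MoonenZarhin1999LowDim, §2 (p0005 L20–L22)] -/
theorem IsSimple.forall_divisorClasses_powPeriod_eq_hodgeClasses_iff_hodgeGroup_eq_lefschetzIdentity_of_finrank_eq_two
    (hX : IsSimple Ψ) (hη : IsRiemannForm Ψ η) (hG : G.map (Rat.cast : ℚ → ℝ) = latticeGram Ψ η) (h2 : finrank ℂ E = 2) :
    (∀ k p : ℕ, divisorClasses (powPeriod Ψ k) p = hodgeClasses (powPeriod Ψ k) p) ↔ hodgeGroup Ψ = lefschetzIdentity Ψ G :=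
  hX.forall_divisorClasses_powPeriod_eq_hodgeClasses_iff_hodgeGroup_eq_lefschetzIdentity_of_not_isAlbertTypeIII hη hG
    (by omega) (hX.not_isAlbertTypeIII_of_finrank_eq_two hη hG h2)

/-- … and `⟺ Hg(X)(ℝ) = S(X)(ℝ)` (Milne's centraliser). [cite: Gordon1999HodgeAVSurvey, Thm. 7.5 (1) ⟺ (2)]
[cite: Milne1999LefschetzClasses, §4 Prop. 4.8 (a) ⟺ (c)] [cite: HulekLaface2019PicardNumbersAV, §5.1 Prop. 5.1] -/
theorem IsSimple.forall_divisorClasses_powPeriod_eq_hodgeClasses_iff_hodgeGroup_eq_lefschetzGroup_of_finrank_eq_two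
    (hX : IsSimple Ψ) (hη : IsRiemannForm Ψ η) (hG : G.map (Rat.cast : ℚ → ℝ) = latticeGram Ψ η) (h2 : finrank ℂ E = 2) :
    (∀ k p : ℕ, divisorClasses (powPeriod Ψ k) p = hodgeClasses (powPeriod Ψ k) p) ↔ hodgeGroup Ψ = lefschetzGroup Ψ η :=
  hX.forall_divisorClasses_powPeriod_eq_hodgeClasses_iff_hodgeGroup_eq_lefschetzGroup_of_not_isAlbertTypeIII hη hG
    (by omega) (hX.not_isAlbertTypeIII_of_finrank_eq_two hη hG h2)

end ComplexTorus

end Literature.Geometry.Kaehler
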